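import Literature.AnabelianGeometry.EtaleTheta.ClassicalThetaRawValue
import Mathlib.NumberTheory.Padics.Complex
import Mathlib.Analysis.Normed.Module.FiniteDimension
import Mathlib.FieldTheory.IntermediateField.Adjoin.Basic
import HarnessLib

/-!
# [EtTh] §1: the theta series CONVERGES in `ℚ̄_p` (`PadicAlgCl p`), and `‖Θ̈(√−1)‖ = ‖2‖` there

Mochizuki, *The étale theta function …* [EtTh], Publ. RIMS **45** (2009), §1, Prop. 1.4 and Def. 1.9 (ii),
PRIMS PDF pp. 21, 29 [cite: MochizukiEtTh2009, Prop 1.4 p.21]. Support file of the abc-iut cell (RQ7 audit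
seat abc-iut-L6-t23, gen 3); proof-only, no named facts.

**Why this file exists.** The §1 statement files evaluate the series `Θ̈` (`ClassicalTheta.thetaDdot`) in
`ℚ̄_p = PadicAlgCl p` (e.g. `ThetaSetting.Prop14iiiValues`, `MuTwoSetting.IsOfStandardType`: the values
`Θ̈(Ü(y))` are compared inside `PadicAlgCl p`), whereas EVERY convergence lemma of `ClassicalTheta*.lean`
assumes `[CompleteSpace 𝕜]` — and `ℚ̄_p` is NOT complete (Mathlib provides no `CompleteSpace (PadicAlgCl p)`;
`PadicAlgCl p = AlgebraicClosure ℚ_[p]` with the spectral norm). The values are nevertheless NOT junk: the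
partial sums lie in the finite extension `ℚ_p(q̈, Ü)`, which is complete, so the series converges in `ℚ̄_p`.
This file PROVES that transfer once and for all:

* `summable_of_norm_bounded_of_mem_submodule` — in a normed space over a complete field, a series whose
  terms lie in a FINITE-DIMENSIONAL submodule and are dominated by a summable real series is summable
  (no completeness of the ambient space);
* `PadicAlgCl.summable_of_norm_bounded_of_mem_adjoin` — the same in `ℚ̄_p` for terms in `ℚ_p(x)`;
* `PadicAlgCl.summable_zpow_mul_succ_nat` / `…_int`, `PadicAlgCl.summable_thetaDdotTerm` — the series
  `Σ q̈^{n(n+1)}` and the theta series converge in `ℚ̄_p` for `‖q̈‖ < 1`;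
* `PadicAlgCl.norm_thetaDdot_sqrt_neg_one` — **`‖Θ̈(√−1)‖ = ‖2‖` in `ℚ̄_p`**, hence `Θ̈(√−1)` is a unit
  iff `p ≠ 2` (`PadicAlgCl.norm_thetaDdot_sqrt_neg_one_lt_one_iff`): the kernel form, ON THE CARRIER THE
  STATEMENT FILES USE, of the author's Comments on [EtTh] (Mar 2022) (vi) («the unique value ∈ K^×», not
  `O_K^×`) and of the standing hypothesis "odd residue characteristic" of Def. 2.5 (cell finding G15 (xliv)).

HONEST FRAMING: elementary `p`-adic analysis; nothing of [EtTh] is asserted; no side is taken on any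
disputed claim.
-/

noncomputable section

namespace Literature.AnabelianGeometry.EtaleTheta

open IsUltrametricDist IntermediateField

/-! ### Summability inside a finite-dimensional submodule (no ambient completeness) -/

/-- In a normed space `E` over a complete nontrivially normed field `𝕜`, a family with values in a
finite-dimensional submodule `S` and norms dominated by a summable real family is summable in `E`
(the finite-dimensional `S` is complete, and the inclusion is continuous).
[cite: NeukirchSchmidtWingberg2008, II §1] -/
theorem summable_of_norm_bounded_of_mem_submodule {𝕜 E ι : Type*} [NontriviallyNormedField 𝕜]
    [CompleteSpace 𝕜] [NormedAddCommGroup E] [NormedSpace 𝕜 E] (S : Submodule 𝕜 E)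
    [FiniteDimensional 𝕜 S] {f : ι → E} {g : ι → ℝ} (hg : Summable g) (h : ∀ i, ‖f i‖ ≤ g i)
    (hf : ∀ i, f i ∈ S) : Summable f := by
  haveI : CompleteSpace S := FiniteDimensional.complete 𝕜 S
  let f' : ι → S := fun i => ⟨f i, hf i⟩
  have h' : Summable f' := Summable.of_norm_bounded hg fun i => by
    change ‖(⟨f i, hf i⟩ : S)‖ ≤ g i
    rw [Submodule.coe_norm]
    exact h i
  have := h'.map S.subtype S.subtypeL.continuous
  exact this

namespace PadicAlgCl

variable {p : ℕ} [Fact p.Prime]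

/-- Every element of `ℚ̄_p` is integral over `ℚ_p`. [cite: NeukirchSchmidtWingberg2008, II §5] -/
theorem isIntegral (x : PadicAlgCl p) : IsIntegral ℚ_[p] x :=
  (Algebra.IsAlgebraic.isAlgebraic (R := ℚ_[p]) x).isIntegral

/-- In `ℚ̄_p`: a family with values in the finite extension `ℚ_p(x)` and norms dominated by a summable real
family is summable (although `ℚ̄_p` itself is not complete). [cite: NeukirchSchmidtWingberg2008, II §5] -/
theorem summable_of_norm_bounded_of_mem_adjoin (x : PadicAlgCl p) {ι : Type*} {f : ι → PadicAlgCl p}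
    {g : ι → ℝ} (hg : Summable g) (h : ∀ i, ‖f i‖ ≤ g i) (hf : ∀ i, f i ∈ ℚ_[p]⟮x⟯) : Summable f := by
  haveI : FiniteDimensional ℚ_[p] ℚ_[p]⟮x⟯ := adjoin.finiteDimensional (isIntegral x)
  haveI : FiniteDimensional ℚ_[p] (Subalgebra.toSubmodule ℚ_[p]⟮x⟯.toSubalgebra) :=
    Subalgebra.finiteDimensional_toSubmodule.mpr (by
      change FiniteDimensional ℚ_[p] ℚ_[p]⟮x⟯
      infer_instance)
  exact summable_of_norm_bounded_of_mem_submodule (Subalgebra.toSubmodule ℚ_[p]⟮x⟯.toSubalgebra) hg h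
    (fun i => hf i)

/-- `Σ_{n∈ℕ} q̈^{n(n+1)}` converges in `ℚ̄_p` for `‖q̈‖ < 1` (terms in `ℚ_p(q̈)`, dominated by the geometric
series). [cite: MochizukiEtTh2009, Prop 1.4 p.21] -/
theorem summable_zpow_mul_succ_nat {q2 : PadicAlgCl p} (hq : ‖q2‖ < 1) :
    Summable fun n : ℕ => q2 ^ ((n : ℤ) * (n + 1)) := by
  refine summable_of_norm_bounded_of_mem_adjoin q2 (summable_geometric_of_lt_one (norm_nonneg _) hq)
    (fun n => ?_) (fun n => zpow_mem (mem_adjoin_simple_self ℚ_[p] q2) _)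
  have hexp : ((n : ℤ) * (n + 1)) = ((n * (n + 1) : ℕ) : ℤ) := by push_cast; ring
  rw [hexp, zpow_natCast, norm_pow]
  exact pow_le_pow_of_le_one (norm_nonneg _) hq.le (by nlinarith : n ≤ n * (n + 1))

/-- `Σ_{n∈ℤ} q̈^{n(n+1)} = 2 · Σ_{n∈ℕ} q̈^{n(n+1)}` in `ℚ̄_p` for `‖q̈‖ < 1` (the symmetry `n ↦ −(n+1)`; no
completeness needed). [cite: MochizukiEtTh2009, Def 1.9 (ii) p.29] -/
theorem tsum_zpow_mul_succ_eq_two_mul {q2 : PadicAlgCl p} (hq : ‖q2‖ < 1) :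
    ∑' n : ℤ, q2 ^ (n * (n + 1)) = 2 * ∑' n : ℕ, q2 ^ ((n : ℤ) * (n + 1)) := by
  have h1 := summable_zpow_mul_succ_nat hq
  have h2 : Summable fun n : ℕ => q2 ^ ((-((n : ℤ) + 1)) * (-((n : ℤ) + 1) + 1)) :=
    h1.congr fun n => by congr 1; ring
  have key := tsum_of_nat_of_neg_add_one (f := fun n : ℤ => q2 ^ (n * (n + 1))) h1 h2
  rw [key, two_mul]
  congr 1
  exact tsum_congr fun n => by congr 1; ring

/-- `‖Σ_{n∈ℕ} q̈^{n(n+1)}‖ = 1` in `ℚ̄_p` for `‖q̈‖ < 1`. [cite: MochizukiEtTh2009, Def 1.9 (ii) p.29] -/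
theorem norm_tsum_nat_zpow_mul_succ {q2 : PadicAlgCl p} (hq : ‖q2‖ < 1) :
    ‖∑' n : ℕ, q2 ^ ((n : ℤ) * (n + 1))‖ = 1 := by
  have hs := summable_zpow_mul_succ_nat hq
  rw [hs.tsum_eq_zero_add]
  have h0 : q2 ^ (((0 : ℕ) : ℤ) * ((0 : ℕ) + 1)) = (1 : PadicAlgCl p) := by simp
  rw [h0]
  have hT : ‖∑' n : ℕ, q2 ^ (((n + 1 : ℕ) : ℤ) * ((n + 1 : ℕ) + 1))‖ < 1 := by
    refine lt_of_le_of_lt (IsUltrametricDist.norm_tsum_le_of_forall_le (C := ‖q2‖ ^ 2) fun n => ?_)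
      (pow_lt_one₀ (norm_nonneg _) hq two_ne_zero)
    have hexp : (((n + 1 : ℕ) : ℤ) * ((n + 1 : ℕ) + 1)) = ((n : ℤ) + 1) * (((n : ℤ) + 1) + 1) := by
      push_cast; ring
    rw [hexp]
    exact norm_zpow_mul_succ_le hq.le (by omega) (by omega)
  have hne : ‖(1 : PadicAlgCl p)‖ ≠ ‖∑' n : ℕ, q2 ^ (((n + 1 : ℕ) : ℤ) * ((n + 1 : ℕ) + 1))‖ := by
    rw [norm_one]; exact (ne_of_lt hT).symm
  rw [IsUltrametricDist.norm_add_eq_max_of_norm_ne_norm hne, norm_one]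
  exact max_eq_left hT.le

/-- **`‖Θ̈(√−1)‖ = ‖2‖` in `ℚ̄_p`** (`‖q̈‖ < 1`, `i² = −1`) — on the carrier the [EtTh] §1 statement files
use, WITHOUT any completeness hypothesis. [cite: MochizukiEtTh2009, Def 1.9 (ii) p.29; Comments (Mar 2022) (vi)] -/
theorem norm_thetaDdot_sqrt_neg_one {i q2 : PadicAlgCl p} (hi : i ^ 2 = -1) (hq : ‖q2‖ < 1) :
    ‖thetaDdot q2 i‖ = ‖(2 : PadicAlgCl p)‖ := by
  have hival : ‖i‖ = 1 := by
    have h : ‖i‖ ^ 2 = 1 := by rw [← norm_pow, hi, norm_neg, norm_one]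
    nlinarith [norm_nonneg i, h]
  rw [thetaDdot_sqrt_neg_one hi q2, tsum_zpow_mul_succ_eq_two_mul hq, norm_mul, norm_mul, hival,
    norm_tsum_nat_zpow_mul_succ hq, one_mul, mul_one]

/-- `‖2‖ < 1` in `ℚ̄_p` iff `p = 2`. [cite: NeukirchSchmidtWingberg2008, II §5] -/
theorem norm_two_lt_one_iff : ‖(2 : PadicAlgCl p)‖ < 1 ↔ p = 2 := by
  have h2 : ((2 : ℚ_[p]) : PadicAlgCl p) = 2 := by norm_cast
  have hn : ‖(2 : PadicAlgCl p)‖ = ‖(2 : ℚ_[p])‖ := by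
    rw [← h2]; exact norm_algebraMap' (PadicAlgCl p) (2 : ℚ_[p])
  rw [hn]
  have : ((2 : ℤ) : ℚ_[p]) = 2 := by norm_cast
  rw [← this, Padic.norm_intCast_lt_one_iff]
  constructor
  · intro h
    have hp : p ∣ 2 := by exact_mod_cast h
    exact (Nat.prime_dvd_prime_iff_eq (Fact.out) Nat.prime_two).mp hp
  · rintro rfl; exact ⟨1, by norm_num⟩

/-- **`Θ̈(√−1)` fails to be a unit of `ℚ̄_p` exactly at `p = 2`**: `‖Θ̈(√−1)‖ < 1 ↔ p = 2` — so the
standard-type normalisation `Θ̈(√−1)⁻¹ · Θ̈` (Thm. 5.7) is an `O^×`-multiple of `Θ̈` iff `p ≠ 2`, which is why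
Def. 2.5 assumes odd residue characteristic and why the author's (vi) replaces `O_K^×` by `K^×` in
Def. 1.9 (ii). [cite: MochizukiEtTh2009, Def 1.9 (ii) p.29; Comments (Mar 2022) (vi)] -/
theorem norm_thetaDdot_sqrt_neg_one_lt_one_iff {i q2 : PadicAlgCl p} (hi : i ^ 2 = -1) (hq : ‖q2‖ < 1) :
    ‖thetaDdot q2 i‖ < 1 ↔ p = 2 := by
  rw [norm_thetaDdot_sqrt_neg_one hi hq, norm_two_lt_one_iff]

/-! ### The full theta series `Θ̈(Ü) = Σ_{n∈ℤ} (−1)^n q̈^{n(n+1)} Ü^{2n+1}` converges in `ℚ̄_p` -/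

/-- In `ℚ̄_p`: a family with values in `ℚ_p(S)`, `S` finite, EVENTUALLY dominated by a summable real family,
is summable. [cite: NeukirchSchmidtWingberg2008, II §5] -/
theorem summable_of_norm_bounded_eventually_of_mem_adjoin (S : Set (PadicAlgCl p)) [Finite S] {ι : Type*}
    {f : ι → PadicAlgCl p} {g : ι → ℝ} (hg : Summable g) (h : ∀ᶠ i in Filter.cofinite, ‖f i‖ ≤ g i)
    (hf : ∀ i, f i ∈ adjoin ℚ_[p] S) : Summable f := by
  haveI : FiniteDimensional ℚ_[p] (adjoin ℚ_[p] S) := finiteDimensional_adjoin fun x _ => isIntegral x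
  let M : Submodule ℚ_[p] (PadicAlgCl p) := Subalgebra.toSubmodule (adjoin ℚ_[p] S).toSubalgebra
  haveI : FiniteDimensional ℚ_[p] M :=
    Subalgebra.finiteDimensional_toSubmodule.mpr (by
      change FiniteDimensional ℚ_[p] (adjoin ℚ_[p] S)
      infer_instance)
  haveI : CompleteSpace M := FiniteDimensional.complete ℚ_[p] M
  let f' : ι → M := fun i => ⟨f i, hf i⟩
  have h' : Summable f' := Summable.of_norm_bounded_eventually hg (h.mono fun i hi => by
    change ‖(⟨f i, hf i⟩ : M)‖ ≤ g i
    rw [Submodule.coe_norm]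
    exact hi)
  exact h'.map M.subtype M.subtypeL.continuous

/-- The half theta series `n ≥ 0` converges in `ℚ̄_p` for `‖q̈‖ < 1`, `q̈ ≠ 0`, `Ü ≠ 0`: the general term has
norm `‖Ü‖ · (‖q̈‖^{n+1} ‖Ü‖²)^n`, eventually `≤ ‖Ü‖ · 2^{-n}`; all terms lie in `ℚ_p(q̈, Ü)`.
[cite: MochizukiEtTh2009, Prop 1.4 p.21] -/
theorem summable_thetaDdotTerm_nat {q2 U : PadicAlgCl p} (hq : ‖q2‖ < 1) (hq0 : q2 ≠ 0) (hU : U ≠ 0) :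
    Summable fun n : ℕ => thetaDdotTerm q2 U n := by
  -- the ratio `r n := ‖q̈‖^{n+1} ‖Ü‖²` tends to `0`
  have hr : Filter.Tendsto (fun n : ℕ => ‖q2‖ ^ (n + 1) * ‖U‖ ^ 2) Filter.atTop (nhds 0) := by
    have h0 : Filter.Tendsto (fun n : ℕ => ‖q2‖ ^ (n + 1)) Filter.atTop (nhds 0) :=
      (Filter.tendsto_add_atTop_iff_nat 1).mpr
        (tendsto_pow_atTop_nhds_zero_of_lt_one (norm_nonneg _) hq)
    simpa using h0.mul_const (‖U‖ ^ 2)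
  have hev : ∀ᶠ n : ℕ in Filter.atTop, ‖q2‖ ^ (n + 1) * ‖U‖ ^ 2 ≤ 1 / 2 :=
    (hr.eventually (ge_mem_nhds (by norm_num : (0 : ℝ) < 1 / 2)))
  refine summable_of_norm_bounded_eventually_of_mem_adjoin {q2, U}
    (g := fun n : ℕ => ‖U‖ * (1 / 2) ^ n)
    ((summable_geometric_of_lt_one (by norm_num) (by norm_num)).mul_left ‖U‖) ?_ ?_
  · rw [Nat.cofinite_eq_atTop]
    filter_upwards [hev] with n hn
    have hnorm : ‖thetaDdotTerm q2 U (n : ℤ)‖ = ‖U‖ * (‖q2‖ ^ (n + 1) * ‖U‖ ^ 2) ^ n := by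
      rw [norm_thetaDdotTerm]
      rw [show ((n : ℤ) * (n + 1)) = (((n + 1) * n : ℕ) : ℤ) by push_cast; ring,
        show (2 * (n : ℤ) + 1) = ((2 * n + 1 : ℕ) : ℤ) by push_cast; ring, zpow_natCast, zpow_natCast,
        mul_pow, ← pow_mul, ← pow_mul, pow_succ, pow_mul]
      ring
    rw [hnorm]
    gcongr
  · intro n
    have hq2 : q2 ∈ adjoin ℚ_[p] ({q2, U} : Set (PadicAlgCl p)) := subset_adjoin _ _ (by simp)
    have hUm : U ∈ adjoin ℚ_[p] ({q2, U} : Set (PadicAlgCl p)) := subset_adjoin _ _ (by simp)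
    unfold thetaDdotTerm
    refine mul_mem (mul_mem ?_ (zpow_mem hq2 _)) (zpow_mem hUm _)
    exact intCast_mem _ _

/-- **The theta series converges in `ℚ̄_p`**: for `‖q̈‖ < 1`, `Σ_{n∈ℤ} (−1)^n q̈^{n(n+1)} Ü^{2n+1}` is summable in
`PadicAlgCl p` for every `Ü` (so `thetaDdot q̈ Ü : PadicAlgCl p` is the genuine sum wherever the §1 statement
files evaluate it). [cite: MochizukiEtTh2009, Prop 1.4 p.21] -/
theorem summable_thetaDdotTerm {q2 : PadicAlgCl p} (hq : ‖q2‖ < 1) (U : PadicAlgCl p) :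
    Summable (thetaDdotTerm q2 U) := by
  by_cases hU : U = 0
  · have : thetaDdotTerm q2 U = 0 := by
      funext n
      have h : (2 : ℤ) * n + 1 ≠ 0 := by omega
      simp [thetaDdotTerm, hU, zero_zpow _ h]
    rw [this]
    exact summable_zero
  by_cases hq0 : q2 = 0
  · refine summable_of_ne_finset_zero (s := {0, -1}) fun n hn => ?_
    have h : n * (n + 1) ≠ 0 := by
      simp only [Finset.mem_insert, Finset.mem_singleton, not_or] at hn
      exact mul_ne_zero hn.1 (by omega)
    simp [thetaDdotTerm, hq0, zero_zpow _ h]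
  refine Summable.of_nat_of_neg_add_one (summable_thetaDdotTerm_nat hq hq0 hU) ?_
  have h : ∀ n : ℕ, thetaDdotTerm q2 U (-((n : ℤ) + 1)) = -thetaDdotTerm q2 U⁻¹ n := fun n => by
    rw [← thetaDdotTerm_inv_neg_succ q2 U⁻¹ n, inv_inv]
  simp only [h]
  exact (summable_thetaDdotTerm_nat hq hq0 (inv_ne_zero hU)).neg

/-- `Θ̈(Ü)` in `ℚ̄_p` is the SUM of its series. [cite: MochizukiEtTh2009, Prop 1.4 p.21] -/
theorem hasSum_thetaDdot {q2 : PadicAlgCl p} (hq : ‖q2‖ < 1) (U : PadicAlgCl p) :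
    HasSum (thetaDdotTerm q2 U) (thetaDdot q2 U) :=
  (summable_thetaDdotTerm hq U).hasSum

/-! ### The values lie in the finite extension `ℚ_p(q̈, Ü)` ("lie in `L^× ⊆ (L^×)^∧`", Prop. 1.4 (iii)) -/

/-- The sum of a summable family with values in `ℚ_p(S)`, `S` finite, lies in `ℚ_p(S)` (a finite-dimensional,
hence closed, subspace of `ℚ̄_p`). [cite: NeukirchSchmidtWingberg2008, II §5] -/
theorem tsum_mem_adjoin (S : Set (PadicAlgCl p)) [Finite S] {ι : Type*} {f : ι → PadicAlgCl p}
    (hs : Summable f) (hf : ∀ i, f i ∈ adjoin ℚ_[p] S) : ∑' i, f i ∈ adjoin ℚ_[p] S := by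
  haveI : FiniteDimensional ℚ_[p] (adjoin ℚ_[p] S) := finiteDimensional_adjoin fun x _ => isIntegral x
  let M : Submodule ℚ_[p] (PadicAlgCl p) := Subalgebra.toSubmodule (adjoin ℚ_[p] S).toSubalgebra
  haveI : FiniteDimensional ℚ_[p] M :=
    Subalgebra.finiteDimensional_toSubmodule.mpr (by
      change FiniteDimensional ℚ_[p] (adjoin ℚ_[p] S)
      infer_instance)
  have hclosed : IsClosed (M : Set (PadicAlgCl p)) := M.closed_of_finiteDimensional
  have hmem : ∀ t : Finset ι, (∑ i ∈ t, f i) ∈ (M : Set (PadicAlgCl p)) :=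
    fun t => M.sum_mem fun i _ => hf i
  exact hclosed.mem_of_tendsto hs.hasSum (Filter.Eventually.of_forall hmem)

/-- **`Θ̈(Ü) ∈ ℚ_p(q̈, Ü)`** in `ℚ̄_p` for `‖q̈‖ < 1` — the kernel form of "the values … lie in `L^× ⊆ (L^×)^∧`"
(Prop. 1.4 (iii), p. 22: for `q̈, Ü ∈ L` the value `Θ̈(Ü)` lies in `L`). [cite: MochizukiEtTh2009, Prop 1.4 (iii) p.22] -/
theorem thetaDdot_mem_adjoin {q2 : PadicAlgCl p} (hq : ‖q2‖ < 1) (U : PadicAlgCl p) :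
    thetaDdot q2 U ∈ adjoin ℚ_[p] ({q2, U} : Set (PadicAlgCl p)) := by
  have hq2 : q2 ∈ adjoin ℚ_[p] ({q2, U} : Set (PadicAlgCl p)) := subset_adjoin _ _ (by simp)
  have hUm : U ∈ adjoin ℚ_[p] ({q2, U} : Set (PadicAlgCl p)) := subset_adjoin _ _ (by simp)
  refine tsum_mem_adjoin {q2, U} (summable_thetaDdotTerm hq U) fun n => ?_
  unfold thetaDdotTerm
  exact mul_mem (mul_mem (intCast_mem _ _) (zpow_mem hq2 _)) (zpow_mem hUm _)

/-- In particular `Θ̈(Ü)` lies in any intermediate field of `ℚ̄_p/ℚ_p` containing `q̈` and `Ü` (e.g. the image of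
`K̈` when `q̈, Ü ∈ K̈`). [cite: MochizukiEtTh2009, Prop 1.4 (iii) p.22] -/
theorem thetaDdot_mem_of_mem {q2 U : PadicAlgCl p} (hq : ‖q2‖ < 1) (L : IntermediateField ℚ_[p] (PadicAlgCl p))
    (hqL : q2 ∈ L) (hUL : U ∈ L) : thetaDdot q2 U ∈ L := by
  have hle : adjoin ℚ_[p] ({q2, U} : Set (PadicAlgCl p)) ≤ L :=
    adjoin_le_iff.mpr (by
      intro x hx
      simp only [Set.mem_insert_iff, Set.mem_singleton_iff] at hx
      rcases hx with rfl | rfl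
      · exact hqL
      · exact hUL)
  exact hle (thetaDdot_mem_adjoin hq U)

end PadicAlgCl

end Literature.AnabelianGeometry.EtaleTheta

end
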